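import Summits.CriticalPhenomena.PercolationContinuityZ3.Theorems.PercNearOneGluingNoHeavyLowerTailMixCSHUnfoldHpart
import Summits.CriticalPhenomena.PercolationContinuityZ3.Theorems.PercNearOneGluingNoHeavyLowerTailMixCSHRemainder
import Summits.CriticalPhenomena.PercolationContinuityZ3.Theorems.PercNearOneGluingNoHeavyLowerTailKNQuestion9OfM1
import Summits.CriticalPhenomena.PercolationContinuityZ3.Theorems.PercNearOneGluingNoHeavyLowerTailKNQuestion9AllWeights
import Summits.CriticalPhenomena.PercolationContinuityZ3.Theorems.PercNearOneGluingNoHeavyLowerTailKnQuestion9Shortening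
import HarnessLib

/-!
# THEOREM M1 — the MIXED conditioned slack hierarchy holds; Kozma–Nitzan's QUESTION 9 for every relay set and CONJECTURE 6 (weights `< 1`)

Support file (`--supports stmt-CriticalPhenomena-4575`), prover `prim-ineq-gen-7` (gen 9).  No definitions, no named facts, no sorries.
Memo `prim-ineq-gen-7/PROOF-Q9-MIXED-CSH.md` Theorem M1 (§3), §4 (Q9), §6 (Conjecture 6); write-up `Q9-WRITEUP.md`.  The assembly of the cell's bricks:
B1 mixed Lemma T (`MixCSH.mixCshMargin_nonneg_of_within`, prim-hp-7 g33) · B2 mixed Lemma U (`MixCSH.mix_within_nonneg`, prim-hp-7 g33) · B3 Lemma R⁻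
(`MixCSH.hubRem_nonpos` ← `CovTau.rminus_world`, this seat) · B4 Lemma H-mix (`MixCSH.hpart_nonneg_hub` ← `CovTau.hubGP`, this seat, consumed inside B2) ·
B5 induction (`MixCSH.mixCSHHolds_of_unfold`, this seat).

* `MixCSH.mixCSH_holds` — **THEOREM M1**: `MixCSHHolds w Σ x Y D o v` for every weight function `< 1`, hub set `Σ`, owner `x ∉ Y`, label `o` and observer `v`
  outside `{x} ∪ Y`, `o ≠ v`, and decoy list `D` (nodup, avoiding `x, Y, o, v`).
* `MixCSH.kn_question9_ltOne` — Kozma–Nitzan's Question 9 on every finite vertex type for weights `< 1` off the observer (`MixCSH.kn_question9_of_M1`);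
* `MixCSH.kn_question9` — **KOZMA–NITZAN QUESTION 9 (arXiv:2401.12397 §5.5) FOR EVERY RELAY SET AND EVERY WEIGHT FUNCTION**: `A ∌ o`, `c ∈ A` minimising
  `P_{G−E(o)}(· ↔ b)` over `A` ⟹ `P(c ↔ b, o ↔ A) ≤ P(o ↔ b, o ↔ A)` (weight-one pairs off `o` contracted away: `KnQ9Contract.question9_allWeights`);
* `MixCSH.kn_question9_socket` — the same in the literal hypothesis shape `hQ9` of prim-lf-2's sockets, whence UNCONDITIONALLY:
  `MixCSH.kn_conjecture6_shorteningStep` (**KOZMA–NITZAN CONJECTURE 6**, §5.3, registered form `stub_shorteningStep`, hypothesis (39) unused),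
  `MixCSH.kn_question7_of_q9` (Question 7 again), `MixCSH.kn_conjecture2form` (Conjecture 2 in form (3)).
[cite: KozmaNitzan2024, Question 9 (§5.5 p. 36), Conjecture 6 (§5.3 p. 34)] [cite: VandenbergHaggstromKahn2005, Thm. 1.1 (pp. 3–5), Thm. 2.1 (p. 9), §2.1 (pp. 9–13)]
-/

noncomputable section

namespace Summit.CriticalPhenomena.PercolationContinuityZ3.Theorems

open MeasureTheory Set Literature.Probability.LatticeModels Literature.Probability.Percolation
open scoped Classical

namespace MixCSH

variable {V : Type*} [Fintype V]

/-- **THEOREM M1 — the mixed conditioned slack hierarchy holds** (memo §3): for weights `< 1`, every hub set `Σ`, owner `x ∉ Y`, label `o ∉ {x} ∪ Y`,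
observer `v ∉ {x} ∪ Y`, `o ≠ v`, and every nodup decoy list avoiding `x, Y, o, v`, the mixed margin is nonnegative for every monotone functional.
[cite: KozmaNitzan2024, Question 9 (§5.5 p. 36)] [cite: VandenbergHaggstromKahn2005, §2.1 (pp. 9–13)] -/
theorem mixCSH_holds (w : Sym2 V → unitInterval) (hw : ∀ e, w e < 1) (Sig : Set V) (x : V) (Y : Set V) (D : List V) (o v : V)
    (hxY : x ∉ Y) (ho : o ∉ insert x Y) (hv : v ∉ insert x Y) (hov : o ≠ v) (hnd : D.Nodup)
    (hdis : ∀ d ∈ D, d ∉ insert x Y ∧ d ≠ o ∧ d ≠ v) : MixCSHHolds w Sig x Y D o v := by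
  refine mixCSHHolds_of_unfold w hw Sig ?_ x Y D o v hxY ho hv hov hnd hdis
  intro x Y D o v _ _ hv hov _ hnd hdis hIH g hg hg0
  have hD' : ∀ d ∈ D, d ≠ x ∧ d ∉ Y ∧ d ≠ o ∧ d ≠ v := fun d hd => by
    obtain ⟨h1, h2, h3⟩ := hdis d hd
    rw [mem_insert_iff, not_or] at h1
    exact ⟨h1.1, h1.2, h2, h3⟩
  convert mix_within_nonneg w hw Sig x Y D o v hov hv hnd hD' hg hg0 hIH
    (fun S d _ _ _ => hubRem_nonpos w x Y hg Sig d S) using 12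

/-- Theorem M1 as the `Fin n` schema consumed by `MixCSH.kn_question9_of_M1` / `MixCSH.shorteningStep_of_M1`. [cite: KozmaNitzan2024, Question 9 (§5.5 p. 36)] -/
theorem m1_schema : ∀ (n : ℕ) (w : Sym2 (Fin n) → unitInterval), (∀ e, w e < 1) →
    ∀ (Sig : Set (Fin n)) (x : Fin n) (Y : Set (Fin n)) (D : List (Fin n)) (o v : Fin n),
      x ∉ Y → o ∉ insert x Y → v ∉ insert x Y → o ≠ v → D.Nodup → (∀ d ∈ D, d ∉ insert x Y ∧ d ≠ o ∧ d ≠ v) →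
      MixCSHHolds w Sig x Y D o v :=
  fun _ w hw Sig x Y D o v => mixCSH_holds w hw Sig x Y D o v

/-- Kozma–Nitzan's Question 9 on every finite vertex type, for weights `< 1` off the observer (`kn_question9_of_M1` fed with Theorem M1).
[cite: KozmaNitzan2024, Question 9 (§5.5 p. 36)] -/
theorem kn_question9_ltOne {W : Type*} [Fintype W] (w : Sym2 W → unitInterval) (o : W)
    (hw : ∀ e : Sym2 W, e ∈ wireSet ({o}ᶜ : Set W) → w e < 1) (A : Finset W) (hoA : o ∉ A) (b c : W) (hcA : c ∈ A)
    (hmin : ∀ a ∈ A, (prodBernoulli (restrW ({o}ᶜ : Set W) w)).real (openConn c b) ≤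
      (prodBernoulli (restrW ({o}ᶜ : Set W) w)).real (openConn a b)) :
    (prodBernoulli w).real (openConn c b ∩ ⋃ a ∈ A, openConn o a) ≤
      (prodBernoulli w).real (openConn o b ∩ ⋃ a ∈ A, openConn o a) :=
  kn_question9_of_M1 m1_schema w o hw A hoA b c hcA hmin

/-- **KOZMA–NITZAN'S QUESTION 9 FOR EVERY RELAY SET, EVERY FINITE WEIGHTED GRAPH, EVERY WEIGHT FUNCTION — UNCONDITIONALLY** (arXiv:2401.12397 §5.5):
for an observer `o ∉ A`, a target `b` and `c ∈ A` with `P_H(c ↔ b) ≤ P_H(a ↔ b)` for all `a ∈ A` in the relay graph `H = G − E(o)` (`restrW {o}ᶜ w`):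
`P_G(c ↔ b ∩ o ↔ A) ≤ P_G(o ↔ b ∩ o ↔ A)`. [cite: KozmaNitzan2024, Question 9 (§5.5 p. 36)] -/
theorem kn_question9 {W : Type*} [Fintype W] (w : Sym2 W → unitInterval) (o : W) (A : Finset W) (hoA : o ∉ A) (b c : W) (hcA : c ∈ A)
    (hmin : ∀ a ∈ A, (prodBernoulli (restrW ({o}ᶜ : Set W) w)).real (openConn c b) ≤
      (prodBernoulli (restrW ({o}ᶜ : Set W) w)).real (openConn a b)) :
    (prodBernoulli w).real (openConn c b ∩ ⋃ a ∈ A, openConn o a) ≤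
      (prodBernoulli w).real (openConn o b ∩ ⋃ a ∈ A, openConn o a) :=
  KnQ9Contract.question9_allWeights (fun w o hw A hoA b c hcA hmin => kn_question9_ltOne w o hw A hoA b c hcA hmin)
    w o A hoA b c hcA hmin

/-- Question 9 in the literal hypothesis shape `hQ9` of prim-lf-2's sockets (`setSourceExchange_of_question9`, `shorteningStep_of_question9`,
`knQuestion7_of_question9`, `conjecture2form_of_question9`). [cite: KozmaNitzan2024, Question 9 (§5.5 p. 36)] -/
theorem kn_question9_socket : ∀ (W : Type) [Fintype W] [DecidableEq W] (w : Sym2 W → unitInterval) (A : Finset W) (o b a : W),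
    o ∉ A → a ∈ A →
    (∀ a' ∈ A, (prodBernoulli (restrW ({o}ᶜ : Set W) w)).real (openConn a b) ≤
      (prodBernoulli (restrW ({o}ᶜ : Set W) w)).real (openConn a' b)) →
    (prodBernoulli w).real (openConn a b ∩ SoloBlindKN.connTo o A) ≤
      (prodBernoulli w).real (openConn o b ∩ SoloBlindKN.connTo o A) :=
  fun _ _ _ w A o b a hoA haA hmin => kn_question9 w o A hoA b a haA hmin

/-- **KOZMA–NITZAN'S CONJECTURE 6, UNCONDITIONALLY** (arXiv:2401.12397 §5.3: the shortening step, in the registered form `stub_shorteningStep` of line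
`kn_shortening_induction`; hypothesis (39) and the induction hypothesis are not used): for every `n`, weights `w` on `Fin n` with `w s(v,x) = 0`, `v ∉ A`,
and the pre-contraction minimiser `a₀ ∈ A` of `P_w(· ↔ b)`:  `P_{w[vx↦1]}(v ↔ A) · P_{w[vx↦1]}(a₀ ↔ b) ≤ P_{w[vx↦1]}(v ↔ b)`.
[cite: KozmaNitzan2024, Conjecture 6 (§5.3 p. 34)] -/
theorem kn_conjecture6_shorteningStep :
    ∀ (n : ℕ) (w : Sym2 (Fin n) → unitInterval) (A : Finset (Fin n)) (b v x a₀ : Fin n),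
      v ∉ A → v ≠ x → w s(v, x) = 0 → a₀ ∈ A →
      (∀ a ∈ A, (prodBernoulli w).real (openConn a₀ b) ≤ (prodBernoulli w).real (openConn a b)) →
      (∀ w' : Sym2 (Fin n) → unitInterval, (∀ e, w e = 0 → w' e = 0) →
        ∀ (A' : Finset (Fin n)) (o' b' : Fin n) (t : ℝ),
          (∀ a ∈ A', t ≤ (prodBernoulli w').real (openConn a b')) →
          (prodBernoulli w').real (⋃ a ∈ A', openConn o' a) * t ≤ (prodBernoulli w').real (openConn o' b')) →
      (prodBernoulli (Function.update w s(v, x) 1)).real (⋃ a ∈ A, openConn v a) *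
          (prodBernoulli (Function.update w s(v, x) 1)).real (openConn a₀ b) ≤
        (prodBernoulli (Function.update w s(v, x) 1)).real (openConn v b) :=
  shorteningStep_of_question9 kn_question9_socket

/-- **Kozma–Nitzan's Question 7** (again, now via Question 9). [cite: KozmaNitzan2024, Question 7 (§5.5 p. 36)] -/
theorem kn_question7_of_q9 {W : Type} [Fintype W] [DecidableEq W] (w : Sym2 W → unitInterval) (A : Finset W) (o : W) :
    SoloBlindKN.KNQuestion7 w A o :=
  SoloBlindKN.knQuestion7_of_question9 kn_question9_socket w A o

/-- **Kozma–Nitzan's Conjecture 2 in form (3)** (min-free), via Question 9. [cite: KozmaNitzan2024, Conjecture 2 (p. 3), Question 9 (p. 36)] -/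
theorem kn_conjecture2form :
    ∀ (n : ℕ) (w : Sym2 (Fin n) → unitInterval) (A : Finset (Fin n)) (o b : Fin n) (t : ℝ), A.Nonempty →
      (∀ a ∈ A, t ≤ (prodBernoulli w).real ((⋃ a' ∈ A, openConn o a') ∩ openConn a b)) →
      t ≤ (prodBernoulli w).real (openConn o b ∩ ⋃ a' ∈ A, openConn o a') :=
  conjecture2form_of_question9 kn_question9_socket

end MixCSH

end Summit.CriticalPhenomena.PercolationContinuityZ3.Theorems
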